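import Summits.KontsevichZagierPeriods.KontsevichZagierPeriods.Theorems.VietaFibreKernelFormBodyDictionary
import Summits.KontsevichZagierPeriods.KontsevichZagierPeriods.Theorems.VietaFibreKernelFormBumpBody
import HarnessLib

/-!
# Crux `KernelForm` (stmt-KontsevichZagierPeriods-10447), line `Sketch`: the volume-one cut

A second cut of the kernel form of Conjecture 1, "at the identity" instead of at the value prime:
localise the formal period ring `P = KZ.FormalRep ⧸ KZ.relations` at the multiplicative set `1 + 𝔭`
(`𝔭 = ker eval`) rather than at `P ∖ 𝔭`. Unbundled over the calculus (no `1` is needed in the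
non-unital `KZ.FormalRep`: `(1 + k) · c` is written `c + k * c`):

* `UnitStabilisation` (inline): `∀ c, eval c = 0 → ∃ k, eval k = 0 ∧ c + k * c ∈ relations` —
  every class of value `0` is killed by some `1 + k` with `k` of value `0` (`𝔭 · P_{1+𝔭} = 0`);
* `UnitCancellation` (inline): `∀ c k, eval k = 0 → c + k * c ∈ relations → c ∈ relations` —
  the elements `1 + 𝔭` are non-zero-divisors (`P → P_{1+𝔭}` injective).

Results (all unconditional; the two halves stay conjecture-grade):

* `kernelForm_iff_unitStabilisation_and_unitCancellation` — THE VOLUME-ONE CUT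
  `KernelForm ↔ UnitStabilisation ∧ UnitCancellation`;
* `weakKernel_of_unitStabilisation`, `unitCancellation_of_cancellation` — comparison with the cut at
  the value prime (`kernelForm_iff`): the transcendence half got stronger, the geometric half weaker;
* `unitStabilisation_iff_body`, `unitCancellation_iff_body` — BODY LANGUAGE, in which no number other
  than `1` occurs: `UnitStabilisation ⟺` every unit-volume body `A` satisfies `K × A ~ K × U` for some
  UNIT-VOLUME body `K`; `UnitCancellation ⟺` unit-volume stabilisers cancel (`vol K = 1`,
  `K × A ~ K × U ⟹ A ~ U`);
* `kernelForm_iff_unitBodies` — Conjecture 1 `⟺` among compact unit-volume `ℚ`-semialgebraic bodies,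
  every body is stably a cube with a unit-volume stabiliser, and unit-volume stabilisers cancel;
  OctahedralSymmetry twin.

Here "body" = compact domain with non-empty interior and integrand `1`, `U` = the unit cube of the
relevant dimension, `A ~ B` = `[A] − [B] ∈ KZ.relations`.

References: M. Kontsevich, D. Zagier, *Periods* (2001), §1.2, Problem 1; J. Cresson, J. Viu-Sos,
JTNB 34 (2022), §1, Problem 2.1; J. Viu-Sos, IJNT 17 (2021), §4.
-/

noncomputable section

open MeasureTheory Set
open Literature.NumberTheory.Transcendental

namespace Summit.KontsevichZagierPeriods.KernelForm.LocaliseAtValuePrime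

/-! ### The volume-one cut -/

/-- **The volume-one cut.** `KernelForm ↔ UnitStabilisation ∧ UnitCancellation`: the kernel form of
Conjecture 1 holds iff every class of value `0` is killed by some `1 + k` with `eval k = 0`, and every
such `1 + k` is a non-zero-divisor modulo the moves. (`→`: `k = 0`, and `eval (c + k * c) = eval c`;
`←`: compose.) [folklore] -/
theorem kernelForm_iff_unitStabilisation_and_unitCancellation :
    Summit.KontsevichZagierPeriods.KontsevichZagierPeriods.Theses.VietaFibre.KernelForm ↔
      (∀ c : KZ.FormalRep, KZ.eval c = 0 →
        ∃ k : KZ.FormalRep, KZ.eval k = 0 ∧ c + k * c ∈ KZ.relations) ∧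
      (∀ c k : KZ.FormalRep, KZ.eval k = 0 → c + k * c ∈ KZ.relations → c ∈ KZ.relations) := by
  unfold Summit.KontsevichZagierPeriods.KontsevichZagierPeriods.Theses.VietaFibre.KernelForm
  constructor
  · intro hK
    refine ⟨fun c hc => ⟨0, by simp, by simpa using hK c hc⟩, fun c k hk h => hK c ?_⟩
    have h0 := eval_eq_zero_of_mem h
    rw [map_add, KZ.eval_mul', hk, zero_mul, add_zero] at h0
    exact h0
  · rintro ⟨hS, hC⟩ c hc
    obtain ⟨k, hk, h⟩ := hS c hc
    exact hC c k hk h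

/-- `[U'] * c ≡ c` for a unit-cube representation `U'` of any dimension (cube multiplication and
commutativity modulo the moves). [folklore] -/
theorem of_cube_mul_sub_mem_relations {m : ℕ} (U' : KZ.IntegralRep m) (hd : U'.domain = KZ.cube m)
    (hi : U'.integrand = fun _ => 1) (c : KZ.FormalRep) : KZ.of U' * c - c ∈ KZ.relations := by
  have e : KZ.of U' * c - c = (KZ.of U' * c - c * KZ.of U') + (c * KZ.of U' - c) := by abel
  rw [e]
  exact KZ.relations.add_mem (KZ.mul_sub_mul_comm_mem_relations _ _) (stub_cubeMul m U' c hd hi)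

/-- The transcendence half of the volume-one cut implies that of the cut at the value prime:
`UnitStabilisation → WeakKernel` (the canceller `[U] + k`, `U` a unit cube, has value `1`). [folklore] -/
theorem weakKernel_of_unitStabilisation
    (hS : ∀ c : KZ.FormalRep, KZ.eval c = 0 →
      ∃ k : KZ.FormalRep, KZ.eval k = 0 ∧ c + k * c ∈ KZ.relations) :
    ∀ c : KZ.FormalRep, KZ.eval c = 0 → ∃ s : KZ.FormalRep, KZ.eval s ≠ 0 ∧ s * c ∈ KZ.relations := by
  intro c hc
  obtain ⟨k, hk, h⟩ := hS c hc
  obtain ⟨U, hUd, hUi⟩ := KZ.exists_oneRep (KZ.isSemialgebraic_cube (n := 0)) (by simp)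
  refine ⟨KZ.of U + k, ?_, ?_⟩
  · rw [map_add, KZ.eval_of, value_eq_one_of_cube U hUd hUi, hk, add_zero]; exact one_ne_zero
  · have e : (KZ.of U + k) * c = (KZ.of U * c - c) + (c + k * c) := by rw [add_mul]; abel
    rw [e]
    exact KZ.relations.add_mem (of_cube_mul_sub_mem_relations U hUd hUi c) h

/-- The geometric half of the cut at the value prime implies that of the volume-one cut:
`Cancellation → UnitCancellation` (same canceller `[U] + k`, value `1 ≠ 0`). [folklore] -/
theorem unitCancellation_of_cancellation
    (hC : ∀ c s : KZ.FormalRep, KZ.eval s ≠ 0 → s * c ∈ KZ.relations → c ∈ KZ.relations) :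
    ∀ c k : KZ.FormalRep, KZ.eval k = 0 → c + k * c ∈ KZ.relations → c ∈ KZ.relations := by
  intro c k hk h
  obtain ⟨U, hUd, hUi⟩ := KZ.exists_oneRep (KZ.isSemialgebraic_cube (n := 0)) (by simp)
  refine hC c (KZ.of U + k) ?_ ?_
  · rw [map_add, KZ.eval_of, value_eq_one_of_cube U hUd hUi, hk, add_zero]; exact one_ne_zero
  · have e : (KZ.of U + k) * c = (KZ.of U * c - c) + (c + k * c) := by rw [add_mul]; abel
    rw [e]
    exact KZ.relations.add_mem (of_cube_mul_sub_mem_relations U hUd hUi c) h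

/-! ### Body language: only the number `1` -/

/-- **Unit stabilisation in body language.** Every class of value `0` is killed by some `1 + k` with
`eval k = 0` iff every compact unit-volume body `A` is stably cube-able WITH A UNIT-VOLUME STABILISER:
there is a compact body `K` of volume `1` with `K × A ~ K × U`. (`→`: for `c = [A] − [U]` get `k`,
put `k ≡ [K] − [U']` in kernel normal form, and use `[U'] * c ≡ c`; `←`: kernel normal form of `c`,
then `k = [K] − [U_K]`.) [folklore] -/
theorem unitStabilisation_iff_body :
    (∀ c : KZ.FormalRep, KZ.eval c = 0 →
        ∃ k : KZ.FormalRep, KZ.eval k = 0 ∧ c + k * c ∈ KZ.relations) ↔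
      ∀ (n : ℕ) (A U : KZ.IntegralRep (n + 1)), IsCompact A.domain → (interior A.domain).Nonempty →
        (∀ x ∈ A.domain, A.integrand x = 1) → A.value = 1 → U.domain = KZ.cube (n + 1) →
        (U.integrand = fun _ => 1) →
        ∃ (m : ℕ) (K : KZ.IntegralRep (m + 1)), IsCompact K.domain ∧ (interior K.domain).Nonempty ∧
          (∀ x ∈ K.domain, K.integrand x = 1) ∧ K.value = 1 ∧
          KZ.of (K.prod A) - KZ.of (K.prod U) ∈ KZ.relations := by
  constructor
  · intro hS n A U _ _ _ hAv hUd hUi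
    have hc : KZ.eval (KZ.of A - KZ.of U) = 0 := by
      rw [map_sub, KZ.eval_of, KZ.eval_of, hAv, value_eq_one_of_cube U hUd hUi, sub_self]
    obtain ⟨k, hk, h⟩ := hS _ hc
    -- kernel normal form of the stabiliser: `k ≡ [K] − [U']`
    obtain ⟨m, K, U', hKc, hKi, hK1, hKv, hU'd, hU'i, e⟩ := exists_unitBody_sub_mem_relations k hk
    refine ⟨m, K, hKc, hKi, hK1, hKv, ?_⟩
    have e' : KZ.of (K.prod A) - KZ.of (K.prod U) =
        (KZ.of A - KZ.of U + k * (KZ.of A - KZ.of U)) -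
          (k - (KZ.of K - KZ.of U')) * (KZ.of A - KZ.of U) +
          (KZ.of U' * (KZ.of A - KZ.of U) - (KZ.of A - KZ.of U)) := by
      rw [← KZ.of_mul_of, ← KZ.of_mul_of]
      simp only [sub_mul, mul_sub]
      abel
    rw [e']
    exact KZ.relations.add_mem (KZ.relations.sub_mem h (KZ.mul_mem_relations_right_holds _ _ e))
      (of_cube_mul_sub_mem_relations U' hU'd hU'i _)
  · intro h c hc
    obtain ⟨n, A, U, hAc, hAi, hA1, hAv, hUd, hUi, e⟩ := exists_unitBody_sub_mem_relations c hc
    obtain ⟨m, K, hKc, hKi, hK1, hKv, hK⟩ := h n A U hAc hAi hA1 hAv hUd hUi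
    obtain ⟨U₁, hU₁d, hU₁i⟩ := KZ.exists_oneRep (KZ.isSemialgebraic_cube (n := m + 1))
      (by simp [KZ.volume_cube])
    refine ⟨KZ.of K - KZ.of U₁, ?_, ?_⟩
    · rw [map_sub, KZ.eval_of, KZ.eval_of, hKv, value_eq_one_of_cube U₁ hU₁d hU₁i, sub_self]
    · have e' : c + (KZ.of K - KZ.of U₁) * c =
          KZ.of K * (c - (KZ.of A - KZ.of U)) + (KZ.of (K.prod A) - KZ.of (K.prod U)) -
            (KZ.of U₁ * c - c) := by
        rw [← KZ.of_mul_of, ← KZ.of_mul_of]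
        simp only [sub_mul, mul_sub]
        abel
      rw [e']
      exact KZ.relations.sub_mem
        (KZ.relations.add_mem (KZ.mul_mem_relations_left_holds _ _ e) hK)
        (of_cube_mul_sub_mem_relations U₁ hU₁d hU₁i c)

/-- **Unit cancellation in body language.** The elements `1 + k`, `eval k = 0`, are
non-zero-divisors modulo the moves iff UNIT-VOLUME STABILISERS CANCEL: for compact bodies `K`, `A` of
volume `1` and the unit cube `U` of the dimension of `A`, `K × A ~ K × U ⟹ A ~ U`. (`→`:
`k = [K] − [U_K]`; `←`: a relation `c + k * c ≡ 0` forces `eval c = 0`, so `c ≡ [A] − [U]` and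
`k ≡ [K] − [U']` by the kernel normal form, whence `K × A ~ K × U`.) [folklore] -/
theorem unitCancellation_iff_body :
    (∀ c k : KZ.FormalRep, KZ.eval k = 0 → c + k * c ∈ KZ.relations → c ∈ KZ.relations) ↔
      ∀ (n m : ℕ) (A U : KZ.IntegralRep (n + 1)) (K : KZ.IntegralRep (m + 1)), IsCompact A.domain →
        (interior A.domain).Nonempty → (∀ x ∈ A.domain, A.integrand x = 1) → A.value = 1 →
        U.domain = KZ.cube (n + 1) → (U.integrand = fun _ => 1) →
        IsCompact K.domain → (interior K.domain).Nonempty → (∀ x ∈ K.domain, K.integrand x = 1) →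
        K.value = 1 →
        KZ.of (K.prod A) - KZ.of (K.prod U) ∈ KZ.relations → KZ.of A - KZ.of U ∈ KZ.relations := by
  constructor
  · intro hC n m A U K _ _ _ _ _ _ _ _ _ hKv hK
    obtain ⟨U₁, hU₁d, hU₁i⟩ := KZ.exists_oneRep (KZ.isSemialgebraic_cube (n := m + 1))
      (by simp [KZ.volume_cube])
    refine hC (KZ.of A - KZ.of U) (KZ.of K - KZ.of U₁) ?_ ?_
    · rw [map_sub, KZ.eval_of, KZ.eval_of, hKv, value_eq_one_of_cube U₁ hU₁d hU₁i, sub_self]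
    · have e' : KZ.of A - KZ.of U + (KZ.of K - KZ.of U₁) * (KZ.of A - KZ.of U) =
          (KZ.of (K.prod A) - KZ.of (K.prod U)) -
            (KZ.of U₁ * (KZ.of A - KZ.of U) - (KZ.of A - KZ.of U)) := by
        rw [← KZ.of_mul_of, ← KZ.of_mul_of]
        simp only [sub_mul, mul_sub]
        abel
      rw [e']
      exact KZ.relations.sub_mem hK (of_cube_mul_sub_mem_relations U₁ hU₁d hU₁i _)
  · intro h c k hk hck
    -- `eval c = 0`
    have hc : KZ.eval c = 0 := by
      have h0 := eval_eq_zero_of_mem hck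
      rw [map_add, KZ.eval_mul', hk, zero_mul, add_zero] at h0
      exact h0
    -- kernel normal forms of `c` and of `k`
    obtain ⟨n, A, U, hAc, hAi, hA1, hAv, hUd, hUi, e⟩ := exists_unitBody_sub_mem_relations c hc
    obtain ⟨m, K, U', hKc, hKi, hK1, hKv, hU'd, hU'i, eK⟩ := exists_unitBody_sub_mem_relations k hk
    -- `[K] * c ∈ relations`
    have hKc' : KZ.of K * c ∈ KZ.relations := by
      have e' : KZ.of K * c = (c + k * c) - (k - (KZ.of K - KZ.of U')) * c + (KZ.of U' * c - c) := by
        simp only [sub_mul]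
        abel
      rw [e']
      exact KZ.relations.add_mem (KZ.relations.sub_mem hck (KZ.mul_mem_relations_right_holds _ _ eK))
        (of_cube_mul_sub_mem_relations U' hU'd hU'i _)
    -- `K × A ~ K × U`, hence `A ~ U`, hence `c ≡ 0`
    have hKAU : KZ.of (K.prod A) - KZ.of (K.prod U) ∈ KZ.relations := by
      have e' : KZ.of (K.prod A) - KZ.of (K.prod U) =
          KZ.of K * c - KZ.of K * (c - (KZ.of A - KZ.of U)) := by
        rw [← KZ.of_mul_of, ← KZ.of_mul_of]
        simp only [mul_sub]
        abel
      rw [e']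
      exact KZ.relations.sub_mem hKc' (KZ.mul_mem_relations_left_holds _ _ e)
    have hAU := h n m A U K hAc hAi hA1 hAv hUd hUi hKc hKi hK1 hKv hKAU
    have e' : c = (c - (KZ.of A - KZ.of U)) + (KZ.of A - KZ.of U) := by abel
    rw [e']
    exact KZ.relations.add_mem e hAU

/-- **Conjecture 1 among unit-volume bodies.** The kernel form of Conjecture 1 holds iff, among
compact `ℚ`-semialgebraic bodies of volume `1`: (i) every body `A` is stably a cube with a unit-volume
stabiliser (`∃ K`, `vol K = 1`, `K × A ~ K × U`), and (ii) unit-volume stabilisers cancel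
(`K × A ~ K × U ⟹ A ~ U`). No number other than `1` occurs in this form of the conjecture.
[folklore] -/
theorem kernelForm_iff_unitBodies :
    Summit.KontsevichZagierPeriods.KontsevichZagierPeriods.Theses.VietaFibre.KernelForm ↔
      (∀ (n : ℕ) (A U : KZ.IntegralRep (n + 1)), IsCompact A.domain → (interior A.domain).Nonempty →
        (∀ x ∈ A.domain, A.integrand x = 1) → A.value = 1 → U.domain = KZ.cube (n + 1) →
        (U.integrand = fun _ => 1) →
        ∃ (m : ℕ) (K : KZ.IntegralRep (m + 1)), IsCompact K.domain ∧ (interior K.domain).Nonempty ∧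
          (∀ x ∈ K.domain, K.integrand x = 1) ∧ K.value = 1 ∧
          KZ.of (K.prod A) - KZ.of (K.prod U) ∈ KZ.relations) ∧
      (∀ (n m : ℕ) (A U : KZ.IntegralRep (n + 1)) (K : KZ.IntegralRep (m + 1)), IsCompact A.domain →
        (interior A.domain).Nonempty → (∀ x ∈ A.domain, A.integrand x = 1) → A.value = 1 →
        U.domain = KZ.cube (n + 1) → (U.integrand = fun _ => 1) →
        IsCompact K.domain → (interior K.domain).Nonempty → (∀ x ∈ K.domain, K.integrand x = 1) →
        K.value = 1 →
        KZ.of (K.prod A) - KZ.of (K.prod U) ∈ KZ.relations → KZ.of A - KZ.of U ∈ KZ.relations) := by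
  rw [kernelForm_iff_unitStabilisation_and_unitCancellation, unitStabilisation_iff_body,
    unitCancellation_iff_body]

/-- **OctahedralSymmetry twin** of `kernelForm_iff_unitBodies`. [folklore] -/
theorem octahedralSymmetry_kernelForm_iff_unitBodies :
    Summit.KontsevichZagierPeriods.KontsevichZagierPeriods.Theses.OctahedralSymmetry.KernelForm ↔
      (∀ (n : ℕ) (A U : KZ.IntegralRep (n + 1)), IsCompact A.domain → (interior A.domain).Nonempty →
        (∀ x ∈ A.domain, A.integrand x = 1) → A.value = 1 → U.domain = KZ.cube (n + 1) →
        (U.integrand = fun _ => 1) →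
        ∃ (m : ℕ) (K : KZ.IntegralRep (m + 1)), IsCompact K.domain ∧ (interior K.domain).Nonempty ∧
          (∀ x ∈ K.domain, K.integrand x = 1) ∧ K.value = 1 ∧
          KZ.of (K.prod A) - KZ.of (K.prod U) ∈ KZ.relations) ∧
      (∀ (n m : ℕ) (A U : KZ.IntegralRep (n + 1)) (K : KZ.IntegralRep (m + 1)), IsCompact A.domain →
        (interior A.domain).Nonempty → (∀ x ∈ A.domain, A.integrand x = 1) → A.value = 1 →
        U.domain = KZ.cube (n + 1) → (U.integrand = fun _ => 1) →
        IsCompact K.domain → (interior K.domain).Nonempty → (∀ x ∈ K.domain, K.integrand x = 1) →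
        K.value = 1 →
        KZ.of (K.prod A) - KZ.of (K.prod U) ∈ KZ.relations → KZ.of A - KZ.of U ∈ KZ.relations) :=
  octahedralSymmetry_kernelForm_iff_vietaFibre_kernelForm.trans kernelForm_iff_unitBodies

end Summit.KontsevichZagierPeriods.KernelForm.LocaliseAtValuePrime
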